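import Literature.MathematicalPhysics.KineticTheory.LambertianRedrawNondegenerate
import HarnessLib

/-!
# Pair form of the cosine Povzner inequality for the Lambertian redraw

Helper file (`--supports`) for the crux `LambertianContactSwap.LambertianEuler`
(`AtomisticToContinuum/HydrodynamicLimit`, stmt-AtomisticToContinuum-11854), line `Sketch`, stub
`stub_lambertPairPovzner : LambertPovzner → LambertPairPovzner`.

At a contact of the pair `(i, j)` with normal `ω = G.sepVec xᵢ xⱼ ≠ 0` the Lambertian redraw
(`Literature.MathematicalPhysics.KineticTheory.lambertPair`) replaces the velocities by
`vᵢ' = c + r • n`, `vⱼ' = c - r • n` with `c = (vᵢ + vⱼ)/2`, `r = ‖vᵢ - vⱼ‖/2` and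
`n = lambertDir ω ξ`, `‖n‖ ∈ {0, 1}` (`lambertPair_apply_left`, `lambertPair_apply_right`,
`norm_lambertDir`).  With `H = ‖c‖² + r² = (‖vᵢ‖² + ‖vⱼ‖²)/2` (parallelogram law) and the
rescaled centre-of-mass velocity `c̃ = a • c`, `H a = 2r`, `‖c̃‖ ≤ 1` (AM–GM, `exists_scale`),
one has POINTWISE in the noise `ξ`
`‖vᵢ'‖^{2k} + ‖vⱼ'‖^{2k} ≤ H^k ((1 + ⟪c̃, n⟫)^k + (1 - ⟪c̃, n⟫)^k)`
with equality off the junk case `n = 0` (`norm_add_smul_sq`, `norm_sub_smul_sq`,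
`pow_add_pow_le`).  Integrating against the standard Gaussian and inserting the direction form of
the geometry-uniform cosine Povzner inequality `E[(1 + ⟪c̃, n⟫)^k + (1 - ⟪c̃, n⟫)^k] ≤ 4·2^k/(k+1)`
(the hypothesis) gives `E[‖vᵢ'‖^{2k} + ‖vⱼ'‖^{2k}] ≤ (4/(k+1)) (‖vᵢ‖² + ‖vⱼ‖²)^k`
(`integral_pow_add_pow_le`, `lambertPairPovzner_of_lambertPovzner`).
-/

noncomputable section

open MeasureTheory ProbabilityTheory Set Function Filter
open scoped ENNReal InnerProductSpace

namespace Summit.AtomisticToContinuum.HydrodynamicLimit.Theorems.LambertianContactSwapLambertianEulerPairPovzner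

open Literature.MathematicalPhysics.KineticTheory Literature.Analysis.FluidPDE

section Pointwise

variable {E : Type*} [NormedAddCommGroup E] [InnerProductSpace ℝ E]

/-- Energy split of the first redrawn velocity: for a unit vector `n` and `(‖c‖² + r²) a = 2r`,
`‖c + r • n‖² = (‖c‖² + r²)(1 + ⟪a • c, n⟫)`. [folklore] -/
theorem norm_add_smul_sq {c n : E} {r a : ℝ} (hn : ‖n‖ = 1)
    (ha : (‖c‖ ^ 2 + r ^ 2) * a = 2 * r) :
    ‖c + r • n‖ ^ 2 = (‖c‖ ^ 2 + r ^ 2) * (1 + ⟪a • c, n⟫_ℝ) := by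
  have hw : ‖r • n‖ ^ 2 = r ^ 2 := by rw [norm_smul, hn, mul_one, Real.norm_eq_abs, sq_abs]
  have hs : ⟪c, r • n⟫_ℝ = r * ⟪c, n⟫_ℝ := real_inner_smul_right c n r
  rw [real_inner_smul_left]
  linear_combination norm_add_sq_real c (r • n) + 2 * hs + hw - ⟪c, n⟫_ℝ * ha

/-- Energy split of the second redrawn velocity: for a unit vector `n` and `(‖c‖² + r²) a = 2r`,
`‖c - r • n‖² = (‖c‖² + r²)(1 - ⟪a • c, n⟫)`. [folklore] -/
theorem norm_sub_smul_sq {c n : E} {r a : ℝ} (hn : ‖n‖ = 1)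
    (ha : (‖c‖ ^ 2 + r ^ 2) * a = 2 * r) :
    ‖c - r • n‖ ^ 2 = (‖c‖ ^ 2 + r ^ 2) * (1 - ⟪a • c, n⟫_ℝ) := by
  have hw : ‖r • n‖ ^ 2 = r ^ 2 := by rw [norm_smul, hn, mul_one, Real.norm_eq_abs, sq_abs]
  have hs : ⟪c, r • n⟫_ℝ = r * ⟪c, n⟫_ℝ := real_inner_smul_right c n r
  rw [real_inner_smul_left]
  linear_combination norm_sub_sq_real c (r • n) - 2 * hs + hw + ⟪c, n⟫_ℝ * ha

/-- **Pointwise domination of the redrawn pair's top-order moment.** If `n` is a unit vector or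
the junk value `0` and `(‖c‖² + r²) a = 2r`, then
`‖c + r • n‖^{2k} + ‖c - r • n‖^{2k} ≤ (‖c‖² + r²)^k ((1 + ⟪a • c, n⟫)^k + (1 - ⟪a • c, n⟫)^k)`
(equality for `‖n‖ = 1`; for `n = 0` this reads `2‖c‖^{2k} ≤ 2(‖c‖² + r²)^k`). [folklore] -/
theorem pow_add_pow_le {c n : E} {r a : ℝ} (hn : ‖n‖ = 1 ∨ n = 0)
    (ha : (‖c‖ ^ 2 + r ^ 2) * a = 2 * r) (k : ℕ) :
    ‖c + r • n‖ ^ (2 * k) + ‖c - r • n‖ ^ (2 * k) ≤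
      (‖c‖ ^ 2 + r ^ 2) ^ k * ((1 + ⟪a • c, n⟫_ℝ) ^ k + (1 - ⟪a • c, n⟫_ℝ) ^ k) := by
  rw [pow_mul, pow_mul]
  rcases hn with hn | rfl
  · rw [norm_add_smul_sq hn ha, norm_sub_smul_sq hn ha, mul_pow, mul_pow, mul_add]
  · simp only [smul_zero, add_zero, sub_zero, inner_zero_right, one_pow]
    have h : (‖c‖ ^ 2) ^ k ≤ (‖c‖ ^ 2 + r ^ 2) ^ k :=
      pow_le_pow_left₀ (sq_nonneg _) (le_add_of_nonneg_right (sq_nonneg _)) k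
    linarith

/-- The rescaling of the centre-of-mass velocity: for `0 ≤ r` there is `a` with
`(‖c‖² + r²) a = 2r` and `‖a • c‖ ≤ 1` (`a = 2r/(‖c‖² + r²)` and AM–GM `2r‖c‖ ≤ ‖c‖² + r²`;
`a = 0` in the degenerate case `c = 0`, `r = 0`). [folklore] -/
theorem exists_scale (c : E) {r : ℝ} (hr : 0 ≤ r) :
    ∃ a : ℝ, (‖c‖ ^ 2 + r ^ 2) * a = 2 * r ∧ ‖a • c‖ ≤ 1 := by
  by_cases h0 : ‖c‖ ^ 2 + r ^ 2 = 0
  · have hr0 : r = 0 := by nlinarith [sq_nonneg ‖c‖, sq_nonneg r]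
    exact ⟨0, by rw [hr0, mul_zero, mul_zero], by rw [zero_smul, norm_zero]; exact zero_le_one⟩
  · have hpos : 0 < ‖c‖ ^ 2 + r ^ 2 := lt_of_le_of_ne (by positivity) (Ne.symm h0)
    refine ⟨2 * r / (‖c‖ ^ 2 + r ^ 2), mul_div_cancel₀ _ h0, ?_⟩
    rw [norm_smul, Real.norm_of_nonneg (by positivity), div_mul_eq_mul_div, div_le_one hpos]
    nlinarith [sq_nonneg (‖c‖ - r), norm_nonneg c]

/-- The Lambertian direction is a unit vector or the junk value `0`. [folklore] -/
theorem norm_lambertDir_eq_one_or (ω ξ : E) : ‖lambertDir ω ξ‖ = 1 ∨ lambertDir ω ξ = 0 :=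
  (eq_or_ne (lambertDir ω ξ) 0).symm.imp_left norm_lambertDir

end Pointwise

/-- **The pair Povzner bound in centre-of-mass variables.** Given the direction form of the
geometry-uniform cosine Povzner inequality, for every contact normal `ω ≠ 0`, every `c` and every
`r ≥ 0`: `E_ξ[‖c + r • n‖^{2k} + ‖c - r • n‖^{2k}] ≤ (4/(k+1)) (2(‖c‖² + r²))^k`,
`n = lambertDir ω ξ`, `ξ` standard Gaussian on `ℝ³`. [folklore] -/
theorem integral_pow_add_pow_le
    (hP : ∀ ω c : V3, ω ≠ 0 → ‖c‖ ≤ 1 → ∀ k : ℕ,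
      ∫ ξ, ((1 + ⟪c, lambertDir ω ξ⟫_ℝ) ^ k + (1 - ⟪c, lambertDir ω ξ⟫_ℝ) ^ k) ∂(stdGaussian V3)
        ≤ 4 * 2 ^ k / (k + 1))
    {ω : V3} (hω : ω ≠ 0) (c : V3) {r : ℝ} (hr : 0 ≤ r) (k : ℕ) :
    ∫ ξ, (‖c + r • lambertDir ω ξ‖ ^ (2 * k) + ‖c - r • lambertDir ω ξ‖ ^ (2 * k))
        ∂(stdGaussian V3)
      ≤ 4 / (k + 1) * (2 * (‖c‖ ^ 2 + r ^ 2)) ^ k := by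
  obtain ⟨a, ha, hac⟩ := exists_scale c hr
  have hbd : ∀ ξ : V3, -1 ≤ ⟪a • c, lambertDir ω ξ⟫_ℝ ∧ ⟪a • c, lambertDir ω ξ⟫_ℝ ≤ 1 := fun ξ =>
    abs_le.1 ((abs_real_inner_le_norm _ _).trans
      (mul_le_one₀ hac (norm_nonneg _) (norm_lambertDir_le_one ω ξ)))
  have hmeas : Measurable fun ξ : V3 => ⟪a • c, lambertDir ω ξ⟫_ℝ :=
    (measurable_const.lambertDir measurable_id).const_inner
  have hint : Integrable (fun ξ : V3 => (‖c‖ ^ 2 + r ^ 2) ^ k *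
      ((1 + ⟪a • c, lambertDir ω ξ⟫_ℝ) ^ k + (1 - ⟪a • c, lambertDir ω ξ⟫_ℝ) ^ k))
      (stdGaussian V3) := by
    refine Integrable.of_bound
      ((((hmeas.const_add 1).pow_const k).add ((hmeas.const_sub 1).pow_const k)).const_mul
        _).aestronglyMeasurable
      ((‖c‖ ^ 2 + r ^ 2) ^ k * (2 ^ k + 2 ^ k)) (ae_of_all _ fun ξ => ?_)
    obtain ⟨h1, h2⟩ := hbd ξ
    have h3 : 0 ≤ 1 + ⟪a • c, lambertDir ω ξ⟫_ℝ := by linarith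
    have h4 : 0 ≤ 1 - ⟪a • c, lambertDir ω ξ⟫_ℝ := by linarith
    rw [Real.norm_of_nonneg (mul_nonneg (pow_nonneg (by positivity) k)
      (add_nonneg (pow_nonneg h3 k) (pow_nonneg h4 k)))]
    exact mul_le_mul_of_nonneg_left (add_le_add (pow_le_pow_left₀ h3 (by linarith) k)
      (pow_le_pow_left₀ h4 (by linarith) k)) (by positivity)
  calc ∫ ξ, (‖c + r • lambertDir ω ξ‖ ^ (2 * k) + ‖c - r • lambertDir ω ξ‖ ^ (2 * k))
          ∂(stdGaussian V3)
      ≤ ∫ ξ, (‖c‖ ^ 2 + r ^ 2) ^ k *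
          ((1 + ⟪a • c, lambertDir ω ξ⟫_ℝ) ^ k + (1 - ⟪a • c, lambertDir ω ξ⟫_ℝ) ^ k)
          ∂(stdGaussian V3) :=
        integral_mono_of_nonneg
          (ae_of_all _ fun ξ => add_nonneg (pow_nonneg (norm_nonneg _) _)
            (pow_nonneg (norm_nonneg _) _))
          hint (ae_of_all _ fun ξ => pow_add_pow_le (norm_lambertDir_eq_one_or ω ξ) ha k)
    _ = (‖c‖ ^ 2 + r ^ 2) ^ k *
          ∫ ξ, ((1 + ⟪a • c, lambertDir ω ξ⟫_ℝ) ^ k + (1 - ⟪a • c, lambertDir ω ξ⟫_ℝ) ^ k)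
            ∂(stdGaussian V3) := integral_const_mul _ _
    _ ≤ (‖c‖ ^ 2 + r ^ 2) ^ k * (4 * 2 ^ k / (k + 1)) :=
        mul_le_mul_of_nonneg_left (hP ω (a • c) hω hac k) (by positivity)
    _ = 4 / (k + 1) * (2 * (‖c‖ ^ 2 + r ^ 2)) ^ k := by rw [mul_pow]; ring

/-- **Pair form of the cosine Povzner inequality** (line `Sketch`, stub `stub_lambertPairPovzner`:
`LambertPovzner → LambertPairPovzner`). If for every contact normal `ω ≠ 0`, every `‖c‖ ≤ 1` and
every `k` the Lambertian direction `n = lambertDir ω ξ` of a standard Gaussian `ξ` satisfies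
`E[(1 + ⟪c, n⟫)^k + (1 - ⟪c, n⟫)^k] ≤ 4·2^k/(k+1)`, then at ANY contact geometry (nonzero
separation vector) the Lambertian redraw of the pair `(i, j)` satisfies
`E_ξ[‖vᵢ'‖^{2k} + ‖vⱼ'‖^{2k}] ≤ (4/(k+1)) (‖vᵢ‖² + ‖vⱼ‖²)^k`: in conditional expectation every
collision of the Lambertian gas keeps at most the fraction `4/(k+1)` of the pair's top-order
moment measured against the kinematic maximum. Proof: energy-split variables
`c = (vᵢ + vⱼ)/2`, `r = ‖vᵢ - vⱼ‖/2`, `‖vᵢ‖² + ‖vⱼ‖² = 2(‖c‖² + r²)` and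
`integral_pow_add_pow_le`. [folklore] -/
theorem lambertPairPovzner_of_lambertPovzner
    (hP : ∀ ω c : V3, ω ≠ 0 → ‖c‖ ≤ 1 → ∀ k : ℕ,
      ∫ ξ, ((1 + ⟪c, lambertDir ω ξ⟫_ℝ) ^ k + (1 - ⟪c, lambertDir ω ξ⟫_ℝ) ^ k) ∂(stdGaussian V3)
        ≤ 4 * 2 ^ k / (k + 1)) :
    ∀ (N : ℕ) (G : Geometry (Fin 3) T3) (i j : Fin N), i ≠ j →
      ∀ z : Config N (Fin 3) T3, G.sepVec (z i).1 (z j).1 ≠ 0 → ∀ k : ℕ,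
        ∫ ξ, (‖(lambertPair G i j z ξ i).2‖ ^ (2 * k) + ‖(lambertPair G i j z ξ j).2‖ ^ (2 * k))
            ∂(stdGaussian V3)
          ≤ 4 / (k + 1) * (‖(z i).2‖ ^ 2 + ‖(z j).2‖ ^ 2) ^ k := by
  intro N G i j hij z hsep k
  have hH : ‖(z i).2‖ ^ 2 + ‖(z j).2‖ ^ 2 =
      2 * (‖(2 : ℝ)⁻¹ • ((z i).2 + (z j).2)‖ ^ 2 + (‖(z i).2 - (z j).2‖ / 2) ^ 2) := by
    rw [norm_smul, norm_inv, Real.norm_two]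
    linear_combination (-1 / 2 : ℝ) * parallelogram_law_with_norm ℝ (z i).2 (z j).2
  have h := integral_pow_add_pow_le hP hsep ((2 : ℝ)⁻¹ • ((z i).2 + (z j).2))
    (r := ‖(z i).2 - (z j).2‖ / 2) (by positivity) k
  rw [hH]
  refine Eq.trans_le (integral_congr_ae (ae_of_all _ fun ξ => ?_)) h
  simp only [lambertPair_apply_left hij, lambertPair_apply_right]

/-- Registered stub `stub_lambertPairPovzner` of line `Sketch` (crux stmt-AtomisticToContinuum-11854):
`LambertPovzner → LambertPairPovzner` with the verbatim registered bodies, closed by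
`lambertPairPovzner_of_lambertPovzner`. [folklore] -/
theorem stub_lambertPairPovzner :
    (∀ ω c : V3, ω ≠ 0 → ‖c‖ ≤ 1 → ∀ k : ℕ,
        ∫ ξ, ((1 + ⟪c, lambertDir ω ξ⟫_ℝ) ^ k + (1 - ⟪c, lambertDir ω ξ⟫_ℝ) ^ k) ∂(stdGaussian V3)
          ≤ 4 * 2 ^ k / (k + 1)) →
    ∀ (N : ℕ) (G : Geometry (Fin 3) T3) (i j : Fin N), i ≠ j →
      ∀ z : Config N (Fin 3) T3, G.sepVec (z i).1 (z j).1 ≠ 0 → ∀ k : ℕ,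
        ∫ ξ, (‖(lambertPair G i j z ξ i).2‖ ^ (2 * k) + ‖(lambertPair G i j z ξ j).2‖ ^ (2 * k))
            ∂(stdGaussian V3)
          ≤ 4 / (k + 1) * (‖(z i).2‖ ^ 2 + ‖(z j).2‖ ^ 2) ^ k :=
  fun hP => lambertPairPovzner_of_lambertPovzner hP

end Summit.AtomisticToContinuum.HydrodynamicLimit.Theorems.LambertianContactSwapLambertianEulerPairPovzner

end
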